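import Summits.CriticalPhenomena.PercolationContinuityZ3.Theorems.PercNearOneGluingNoHeavyLowerTailHullThreeJoin
import Literature.Probability.LatticeModels.ProdBernoulliIndependence
import HarnessLib

/-!
# `NoHeavyLowerTail` (stmt-CriticalPhenomena-4575) — hull-port line, THREE PORTS: events on pattern cells and the hull
# decomposition of G-level quantities

Hull-port prover #4 (`prim-hp-4`, LP-duality technique), generation 2; `--supports stmt-CriticalPhenomena-4575`.  No sorries, no named
facts.  Companion of `…HullThreeJoin` (three-port hulls `Hull3`, inner/outer bits, the join lemma).

For a three-port hull `X`, relays `A` outside the region with the ports among them, and a level `j`: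
* `Hull3.piOut A ω I` = the relays outer-joined to the ports of the mask `I`; `Hull3.Hs A j ω I = 1{|piOut| ≤ j}` — the antitone
  LIGHTNESS FUNCTION of the outer configuration (`Hs_antitone`);
* `Hull3.cell b` = the configurations with inner bits `b`, `Hull3.xlaw b` = its probability (the INNER LAW; it vanishes off the
  closed patterns, `xlaw_eq_zero_of_not_closed`);
* cluster formulas on the support event (`filter_vtx_eq`, `filter_pair_eq`, `one_le_card_iff_att`, `mem_openConn_port_iff`): the
  relays joined to a named point are `piOut` of its join block, the observer is attached iff `att (ibits ω)`;
* `Hull3.decomp_event` (**hull decomposition**): if on the support event `ω ∈ G ↔ P (ibits ω) (obits ω) ∧ |piOut ω (m …)| ≤ j`, then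
  `μ(G) = Σ_b xlaw b · ∫ (if P b (obits ω) then Hs ω (m b (obits ω)) else 0) dμ` — inner pattern and outer data are independent
  (`prodBernoulli_real_inter_of_determinedBy`), and the pattern cells partition the space.
-/

noncomputable section

namespace Summit.CriticalPhenomena.PercolationContinuityZ3.Theorems

open MeasureTheory Set Literature.Probability.LatticeModels Literature.Probability.Percolation
open scoped Classical BigOperators

variable {n : ℕ}

namespace HullThree

namespace Hull3

variable (X : Hull3 n) (A : Finset (Fin n)) (j : ℕ)

/-- The relays outer-joined to the ports of the mask `I`. -/
def piOut (ω : BondConfig (Fin n)) (I : M3) : Finset (Fin n) :=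
  A.filter fun a => ∃ i : Fin 3, I.mem i = true ∧ (X.Gout ω).Reachable (X.p i) a

/-- The lightness function of the outer configuration: `1` iff at most `j` relays are outer-joined to the ports of `I`. -/
def Hs (ω : BondConfig (Fin n)) (I : M3) : ℝ := if (X.piOut A ω I).card ≤ j then 1 else 0

/-- The pattern cell of the inner bits `b`. -/
def cell (b : IB) : Set (BondConfig (Fin n)) := {ω | X.ibits ω = b}

/-- The inner law: the probability of the pattern cell. -/
def xlaw (b : IB) : ℝ := (prodBernoulli X.w).real (X.cell b)

variable {X A j}

/-! ### Lightness is antitone, the inner law vanishes off closed patterns -/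

/-- `piOut` is monotone in the mask. -/
theorem piOut_mono (ω : BondConfig (Fin n)) {I I' : M3} (h : I.sub I' = true) : X.piOut A ω I ⊆ X.piOut A ω I' := by
  intro a ha
  rw [piOut, Finset.mem_filter] at ha ⊢
  obtain ⟨haA, i, hi, hr⟩ := ha
  exact ⟨haA, i, (M3.sub_iff I I').1 h i hi, hr⟩

/-- `Hs` is antitone in the mask and takes values in `{0,1}`. -/
theorem Hs_antitone (ω : BondConfig (Fin n)) (I I' : M3) (h : I.sub I' = true) : X.Hs A j ω I' ≤ X.Hs A j ω I := by
  unfold Hs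
  have hc : (X.piOut A ω I).card ≤ (X.piOut A ω I').card := Finset.card_le_card (piOut_mono ω h)
  split_ifs with h1 h2
  · exact le_rfl
  · exact absurd (hc.trans h1) h2
  · exact zero_le_one
  · exact le_rfl

/-- The inner law is nonnegative. -/
theorem xlaw_nonneg (b : IB) : 0 ≤ X.xlaw b := measureReal_nonneg

/-- Non-closed bit records have empty cells. -/
theorem xlaw_eq_zero_of_not_closed (b : IB) (hb : b.closed = false) : X.xlaw b = 0 := by
  have : X.cell b = ∅ := by
    ext ω
    simp only [cell, mem_setOf_eq, mem_empty_iff_false, iff_false]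
    intro h
    have := closed_ibits (X := X) ω
    rw [h, hb] at this
    exact Bool.false_ne_true this
  rw [xlaw, this, measureReal_empty]

/-! ### Cluster formulas on the support event -/

/-- The relays joined to a named point are the relays outer-joined to its join block. -/
theorem filter_vtx_eq (hA : ∀ a ∈ A, a ∉ X.R) {ω : BondConfig (Fin n)} (hω : ω ∈ X.supp) (u : NP) :
    (A.filter fun a => ω ∈ openConn (X.vtx u) a) =
      X.piOut A ω (M3.ofFn fun i => jrel (X.ibits ω) (X.obits ω) u (some i)) := by
  ext a
  simp only [Finset.mem_filter, piOut, M3.mem_ofFn, and_congr_right_iff]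
  intro ha
  exact reach_iff_join hω u (hA a ha)

/-- Observer count: `π(o) = piOut (blkS)`. -/
theorem filter_obs_eq (hA : ∀ a ∈ A, a ∉ X.R) {ω : BondConfig (Fin n)} (hω : ω ∈ X.supp) :
    (A.filter fun a => ω ∈ openConn X.o a) = X.piOut A ω (blkS (X.ibits ω) (X.obits ω)) :=
  filter_vtx_eq hA hω none

/-- Port count: `π(p k) = piOut (blkP k)`. -/
theorem filter_port_eq (hA : ∀ a ∈ A, a ∉ X.R) {ω : BondConfig (Fin n)} (hω : ω ∈ X.supp) (k : Fin 3) :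
    (A.filter fun a => ω ∈ openConn (X.p k) a) = X.piOut A ω (blkP (X.ibits ω) (X.obits ω) k) :=
  filter_vtx_eq hA hω (some k)

/-- Set count for one port: `π({p k}) = piOut (blkP k)`. -/
theorem filter_single_eq (hA : ∀ a ∈ A, a ∉ X.R) {ω : BondConfig (Fin n)} (hω : ω ∈ X.supp) (k : Fin 3) :
    (A.filter fun z => ∃ x ∈ ({X.p k} : Finset (Fin n)), ω ∈ openConn x z) =
      X.piOut A ω (blkP (X.ibits ω) (X.obits ω) k) := by
  rw [← filter_port_eq hA hω k]
  ext z
  simp only [Finset.mem_filter, Finset.mem_singleton, exists_eq_left]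

/-- Set count for the two worse ports: `π({p 1, p 2}) = piOut (blkP 1 ∪ blkP 2)`. -/
theorem filter_pair_eq (hA : ∀ a ∈ A, a ∉ X.R) {ω : BondConfig (Fin n)} (hω : ω ∈ X.supp) :
    (A.filter fun z => ∃ x ∈ ({X.p 1, X.p 2} : Finset (Fin n)), ω ∈ openConn x z) =
      X.piOut A ω ((blkP (X.ibits ω) (X.obits ω) 1).union (blkP (X.ibits ω) (X.obits ω) 2)) := by
  ext z
  simp only [Finset.mem_filter, Finset.mem_insert, Finset.mem_singleton, exists_eq_or_imp, exists_eq_left, piOut,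
    M3.mem_union, Bool.or_eq_true, and_congr_right_iff]
  intro hz
  rw [show (ω ∈ openConn (X.p 1) z) = (openGraph ω).Reachable (X.vtx (some 1)) z from rfl,
    show (ω ∈ openConn (X.p 2) z) = (openGraph ω).Reachable (X.vtx (some 2)) z from rfl,
    reach_iff_join hω (some 1) (hA z hz), reach_iff_join hω (some 2) (hA z hz)]
  simp only [blkP, M3.mem_ofFn]
  constructor
  · rintro (⟨i, h1, h2⟩ | ⟨i, h1, h2⟩)
    · exact ⟨i, Or.inl h1, h2⟩
    · exact ⟨i, Or.inr h1, h2⟩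
  · rintro ⟨i, h1 | h1, h2⟩
    · exact Or.inl ⟨i, h1, h2⟩
    · exact Or.inr ⟨i, h1, h2⟩

/-- `o ↔ p k` iff `k ∈ blkS`. -/
theorem mem_openConn_obs_iff {ω : BondConfig (Fin n)} (hω : ω ∈ X.supp) (k : Fin 3) :
    ω ∈ (openConn X.o (X.p k) : Set (BondConfig (Fin n))) ↔ (blkS (X.ibits ω) (X.obits ω)).mem k = true := by
  rw [blkS, M3.mem_ofFn]
  exact reach_port_iff hω none k

/-- `p 0 ↔ p k` iff `k ∈ blkP 0`. -/
theorem mem_openConn_port_iff {ω : BondConfig (Fin n)} (hω : ω ∈ X.supp) (l k : Fin 3) :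
    ω ∈ (openConn (X.p l) (X.p k) : Set (BondConfig (Fin n))) ↔ (blkP (X.ibits ω) (X.obits ω) l).mem k = true := by
  rw [blkP, M3.mem_ofFn]
  exact reach_port_iff hω (some l) k

/-- `jrel`-attachment forces inner attachment (no inner bit at `o` means `o` is isolated in the join). -/
theorem att_of_jrel : ∀ (b : IB) (c : OB) (i : Fin 3), jrel b c none (some i) = true → att b = true := by
  decide +kernel

/-- The observer is attached (`1 ≤ N`) iff `att (ibits ω)`. -/
theorem one_le_card_iff_att (hA : ∀ a ∈ A, a ∉ X.R) (hpA : ∀ i, X.p i ∈ A) {ω : BondConfig (Fin n)} (hω : ω ∈ X.supp) :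
    1 ≤ (A.filter fun a => ω ∈ openConn X.o a).card ↔ att (X.ibits ω) = true := by
  rw [Nat.one_le_iff_ne_zero, Ne, Finset.card_eq_zero, ← Ne, ← Finset.nonempty_iff_ne_empty, Finset.filter_nonempty_iff]
  constructor
  · rintro ⟨a, ha, hr⟩
    obtain ⟨i, hi, -⟩ := (reach_iff_join hω none (hA a ha)).1 hr
    exact att_of_jrel _ _ i hi
  · intro h
    -- some `o`-bit is on: `o` is inner-joined to a port
    have : ∃ i : Fin 3, X.ir ω none (some i) = true := by
      simp only [att, ibits, Bool.or_eq_true] at h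
      rcases h with (h | h) | h
      exacts [⟨0, h⟩, ⟨1, h⟩, ⟨2, h⟩]
    obtain ⟨i, hi⟩ := this
    simp only [ir, decide_eq_true_iff] at hi
    exact ⟨X.p i, hpA i, hi.2.mono (Gin_le ω)⟩

/-- A port set always meets at least one relay (itself). -/
theorem one_le_card_set (hpA : ∀ i, X.p i ∈ A) (ω : BondConfig (Fin n)) (O : Finset (Fin n)) (k : Fin 3)
    (hk : X.p k ∈ O) : 1 ≤ (A.filter fun z => ∃ x ∈ O, ω ∈ openConn x z).card := by
  rw [Nat.one_le_iff_ne_zero, Ne, Finset.card_eq_zero, ← Ne, ← Finset.nonempty_iff_ne_empty, Finset.filter_nonempty_iff]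
  exact ⟨X.p k, hpA k, X.p k, hk, SimpleGraph.Reachable.refl _⟩

/-! ### Supports: inner bits are read inside `F`, outer data outside `F` -/

/-- The inner bits are read inside `F`. -/
theorem ibits_congr {ω ω' : BondConfig (Fin n)} (h : ω ∩ ↑X.F = ω' ∩ ↑X.F) : X.ibits ω = X.ibits ω' := by
  unfold ibits ir Gin
  rw [h]

/-- The outer bits are read outside `F`. -/
theorem obits_congr {ω ω' : BondConfig (Fin n)} (h : ω ∩ (↑X.F)ᶜ = ω' ∩ (↑X.F)ᶜ) : X.obits ω = X.obits ω' := by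
  unfold obits orr Gout
  rw [h]

/-- `piOut` is read outside `F`. -/
theorem piOut_congr {ω ω' : BondConfig (Fin n)} (h : ω ∩ (↑X.F)ᶜ = ω' ∩ (↑X.F)ᶜ) (I : M3) :
    X.piOut A ω I = X.piOut A ω' I := by
  simp only [piOut, Gout, h]

/-- Pattern cells are determined by the inner pairs. -/
theorem determinedBy_cell (b : IB) : DeterminedBy (X.cell b) (↑X.F : Set (Sym2 (Fin n))) := by
  rw [determinedBy_iff]
  intro ω ω' h
  simp only [cell, mem_setOf_eq, ibits_congr h]

/-- The outer event of a pattern functional. -/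
def Oev (X : Hull3 n) (A : Finset (Fin n)) (j : ℕ) (P : IB → OB → Prop) (m : IB → OB → M3) (b : IB) :
    Set (BondConfig (Fin n)) :=
  {ω | P b (X.obits ω) ∧ (X.piOut A ω (m b (X.obits ω))).card ≤ j}

/-- Outer events are determined by the outer pairs. -/
theorem determinedBy_Oev (P : IB → OB → Prop) (m : IB → OB → M3) (b : IB) :
    DeterminedBy (X.Oev A j P m b) (↑X.F : Set (Sym2 (Fin n)))ᶜ := by
  rw [determinedBy_iff]
  intro ω ω' h
  simp only [Oev, mem_setOf_eq, obits_congr h, piOut_congr h]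

/-! ### The hull decomposition of an event -/

/-- The pattern cells partition the space: `μ(G) = Σ_b μ(G ∩ cell b)`. -/
theorem real_eq_sum_cells (w' : Sym2 (Fin n) → unitInterval) (G : Set (BondConfig (Fin n))) :
    (prodBernoulli w').real G = ∑ b : IB, (prodBernoulli w').real (G ∩ X.cell b) := by
  have h := sum_measureReal_preimage_singleton (μ := (prodBernoulli w').restrict G) (Finset.univ : Finset IB)
    (f := X.ibits) (fun _ _ => MeasurableSet.of_discrete)
  rw [Finset.coe_univ, preimage_univ, measureReal_restrict_apply_univ] at h
  rw [← h]
  refine Finset.sum_congr rfl fun b _ => ?_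
  rw [measureReal_restrict_apply MeasurableSet.of_discrete, inter_comm]
  rfl

/-- Intersecting with the support event does not change probabilities. -/
theorem real_inter_supp (E : Set (BondConfig (Fin n))) :
    (prodBernoulli X.w).real (E ∩ X.supp) = (prodBernoulli X.w).real E :=
  CutObserver.measureReal_inter_support X.w E

/-- **Hull decomposition of an event.**  If on the support event `G` reads `P (ibits) (obits) ∧ |piOut (m …)| ≤ j`, then
`μ(G) = Σ_b xlaw b · ∫ (if P b (obits ω) then Hs ω (m b (obits ω)) else 0) dμ`. -/
theorem decomp_event (P : IB → OB → Prop) [∀ b c, Decidable (P b c)] (m : IB → OB → M3) (G : Set (BondConfig (Fin n)))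
    (hG : ∀ ω ∈ X.supp, ω ∈ G ↔ P (X.ibits ω) (X.obits ω) ∧ (X.piOut A ω (m (X.ibits ω) (X.obits ω))).card ≤ j) :
    (prodBernoulli X.w).real G =
      ∑ b : IB, X.xlaw b * ∫ ω, (if P b (X.obits ω) then X.Hs A j ω (m b (X.obits ω)) else 0) ∂(prodBernoulli X.w) := by
  rw [real_eq_sum_cells X.w G]
  refine Finset.sum_congr rfl fun b _ => ?_
  -- on the support event, `G ∩ cell b = Oev b ∩ cell b`
  have hset : G ∩ X.cell b ∩ X.supp = X.cell b ∩ X.Oev A j P m b ∩ X.supp := by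
    ext ω
    simp only [mem_inter_iff, cell, Oev, mem_setOf_eq]
    constructor
    · rintro ⟨⟨hG', hb⟩, hω⟩
      have := (hG ω hω).1 hG'
      rw [hb] at this
      exact ⟨⟨hb, this⟩, hω⟩
    · rintro ⟨⟨hb, hP⟩, hω⟩
      refine ⟨⟨(hG ω hω).2 ?_, hb⟩, hω⟩
      rw [hb]; exact hP
  rw [← real_inter_supp, hset, real_inter_supp,
    prodBernoulli_real_inter_of_determinedBy X.w X.F (determinedBy_cell b) (determinedBy_Oev P m b)
      MeasurableSet.of_discrete MeasurableSet.of_discrete]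
  unfold xlaw
  congr 1
  -- `μ(Oev b)` as an integral
  rw [← integral_indicator_one (MeasurableSet.of_discrete (s := X.Oev A j P m b))]
  refine integral_congr_ae (Filter.Eventually.of_forall fun ω => ?_)
  simp only [indicator, Oev, mem_setOf_eq, Hs, Pi.one_apply]
  by_cases hP : P b (X.obits ω)
  · simp only [hP, true_and, if_true]
  · simp only [hP, false_and, if_false]

end Hull3

end HullThree

end Summit.CriticalPhenomena.PercolationContinuityZ3.Theorems

end
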